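import Mathlib
import Literature.LinearAlgebra.Matrix.PermanentEqualRows
import Literature.Computability.AlgebraicComplexity.StandardFamilies
import Summits.ValiantsHypothesis.ValiantsHypothesis.Theorems.FreeSubtorusOrbitDimensionBoundStubMultilinearVanish
import Summits.ValiantsHypothesis.ValiantsHypothesis.Theorems.FreeSubtorusOrbitDimensionBoundStubFiltrationFinrank
import Summits.ValiantsHypothesis.ValiantsHypothesis.Theorems.FreeSubtorusOrbitDimensionBoundStubPerProductBound
import Summits.ValiantsHypothesis.ValiantsHypothesis.Theorems.FreeSubtorusOrbitDimensionBoundStubSliceRankOfBound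

/-!
# Crux `FreeSubtorus.OrbitDimensionBound` (stmt-ValiantsHypothesis-16133), line `Sketch`, §5 —
# linear subspaces on which the permanent vanishes, and the slice rank of the permanent

**Theorem (`perVanishingSubspace_bound`, all `n`).**  A linear subspace `U ≤ M_n(ℂ)` on which
`per_n` vanishes identically has `dim U ≤ n² - n` (written `dim U + n ≤ n·n`; equality for the
matrices with a zero row).  The determinant analogue is Dieudonné's lemma
[Landsberg 2017, Lemma 6.6.1.4]; for the permanent the statement was not found in print (presearch
in the lead's NOTES.md) and is proved here from scratch.

**Corollary (`sliceRank_perPoly`): `sr(per_n) = str_1(per_n) = n`** — every decomposition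
`per_n = Σ_{t<w} ℓ_t h_t` with LINEAR forms `ℓ_t` has `w ≥ n` (Laplace along one row attains `n`);
by Gesmundo–Ghosal–Ikenmeyer–Lysikov (Prop. 9: `sr(F) ≤ r` iff `{F = 0}` contains a linear
subspace of codimension `r`; Thm. 12: a homogeneous ABP for `F` has `≥ Σ_j str_j(F)` vertices) both
end levels of every homogeneous algebraic branching program computing `per_n` have `≥ n` vertices.
This is the rung `j = 1` of the restricted-strength ladder through which the crux
`OrbitDimensionBound` is calibrated at `n = 4` (crux ⇒ homothety lifts at the optimal size, tree
`homothetyLifts_of_orbitDimensionBound`; the next rung is the number `str_2(per_4)`).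

**Proof of the theorem.**  (a) Product reduction: with the row filtration
`F_i = {X ∈ U : X_j = 0 (j < i)}` and the row spaces `K_i = row_i(F_i) ≤ ℂⁿ` one has
`Σ_i dim K_i = dim U` (`stub_filtrationFinrank`, p173141) and `per` vanishes on EVERY matrix with
rows `k_i ∈ K_i` (`productVanish` below: by induction on the number `m` of frozen rows, for
`W_m ∈ F_m` with row `m` equal to `k_m` and `Y ∈ F_{m+1}` the function
`t ↦ per(k_{<m}; W_m + tY)` vanishes identically and its top coefficient in the rows `> m`,
`per(k_{≤m}; Y_{>m})`, is the next instance — `stub_multilinearVanish`, p173040, applied to the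
permanent as a multilinear function of the rows).  (b) The multilinear bound
`Σ dim K_i + n ≤ n·n` (`stub_perProductBound`, p173236: induction on `n` through a full row and
the Laplace expansion of the permanent).  (c) The slice-rank corollary
(`stub_sliceRankOfBound`, p173209: `per` vanishes on `⋂ ker ℓ_t`, of dimension `≥ n² - w`).
-/

-- Sub = Summit single-conjunct layout: the duplicated namespace component is mandated by the tree.
set_option linter.dupNamespace false

noncomputable section

namespace Summit.ValiantsHypothesis.ValiantsHypothesis.Theorems.FreeSubtorusOrbitDimensionBound

open Matrix Finset

/-- **Product reduction, vanishing half.**  If `per` vanishes on the subspace `U ≤ M_n(ℂ)`, it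
vanishes on EVERY matrix whose `i`-th row lies in the `i`-th row space
`K_i = row_i {X ∈ U : X_j = 0 (j < i)}` of the row filtration (induction on the number `m` of frozen
rows: `t ↦ per(k_{<m}; W_m + tY)` vanishes identically for `W_m, Y` in the `m`-th filtration step,
and its top coefficient in the rows `> m` is the next instance; `stub_multilinearVanish` applied to
the permanent as a multilinear function of the rows, row-additivity from
`permanent_updateRow_add`). [folklore] -/
theorem productVanish {n : ℕ} (U : Submodule ℂ (Fin n → Fin n → ℂ))
    (hU : ∀ X ∈ U, (Matrix.of X).permanent = 0) (k : Fin n → Fin n → ℂ)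
    (hk : ∀ i, k i ∈ (U ⊓ ⨅ j ∈ Finset.univ.filter (fun j : Fin n => j < i),
        LinearMap.ker (LinearMap.proj j : (Fin n → Fin n → ℂ) →ₗ[ℂ] (Fin n → ℂ))).map
          (LinearMap.proj i : (Fin n → Fin n → ℂ) →ₗ[ℂ] (Fin n → ℂ))) :
    (Matrix.of k).permanent = 0 := by
  classical
  -- the permanent as a multilinear function of the rows
  let perRows : MultilinearMap ℂ (fun _ : Fin n => Fin n → ℂ) ℂ :=
    { toFun := fun X => (Matrix.of X).permanent
      map_update_add' := by
        intro inst X i u v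
        have h := Literature.LinearAlgebra.Matrix.permanent_updateRow_add
          (show Matrix (Fin n) (Fin n) ℂ from X) i u v
        simp only [Matrix.updateRow] at h
        convert h
      map_update_smul' := by
        intro inst X i c u
        have h := Matrix.permanent_updateRow_smul (show Matrix (Fin n) (Fin n) ℂ from X) i c u
        simp only [Matrix.updateRow] at h
        rw [smul_eq_mul]
        convert h }
  have mem_filt : ∀ (i : Fin n) (X : Fin n → Fin n → ℂ),
      X ∈ (U ⊓ ⨅ j ∈ Finset.univ.filter (fun j : Fin n => j < i),
        LinearMap.ker (LinearMap.proj j : (Fin n → Fin n → ℂ) →ₗ[ℂ] (Fin n → ℂ))) ↔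
      X ∈ U ∧ ∀ j : Fin n, j < i → X j = 0 := by
    intro i X
    simp [Submodule.mem_inf, Submodule.mem_iInf, LinearMap.mem_ker]
  -- witnesses `W i` in the `i`-th filtration step with `W i i = k i`
  have hW : ∀ i : Fin n, ∃ W : Fin n → Fin n → ℂ, W ∈ U ∧ (∀ j : Fin n, j < i → W j = 0) ∧ W i = k i := by
    intro i
    obtain ⟨W, hWF, hWi⟩ := Submodule.mem_map.1 (hk i)
    exact ⟨W, ((mem_filt i W).1 hWF).1, ((mem_filt i W).1 hWF).2, hWi⟩
  choose W hWU hWz hWk using hW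
  -- the frozen matrices `Z m Y = (k_{<m}; Y_{≥ m})`
  let Z : ℕ → (Fin n → Fin n → ℂ) → (Fin n → Fin n → ℂ) := fun m Y i => if (i : ℕ) < m then k i else Y i
  have hZ : ∀ m : ℕ, m ≤ n → ∀ Y ∈ U, (∀ j : Fin n, (j : ℕ) < m → Y j = 0) →
      (Matrix.of (Z m Y)).permanent = 0 := by
    intro m
    induction m with
    | zero =>
      intro _ Y hY _
      have : Z 0 Y = Y := by funext i; simp [Z]
      rw [this]; exact hU Y hY
    | succ m ih =>
      intro hm Y hY hY0
      have hmn : m < n := Nat.lt_of_succ_le hm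
      set im : Fin n := ⟨m, hmn⟩ with him
      -- `x = Z m (W im)`, `y = (0_{≤ m}; Y_{> m})`, `S = {i : m < i}`
      let x : Fin n → Fin n → ℂ := Z m (W im)
      let y : Fin n → Fin n → ℂ := fun i => if (i : ℕ) ≤ m then 0 else Y i
      let S : Finset (Fin n) := Finset.univ.filter (fun i : Fin n => m < (i : ℕ))
      have hyS : ∀ i, i ∉ S → y i = 0 := by
        intro i hi
        have : ¬ m < (i : ℕ) := by simpa [S] using hi
        simp [y, Nat.le_of_not_lt this]
      have hline : ∀ t : ℂ, perRows (x + t • y) = 0 := by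
        intro t
        have hmem : W im + t • Y ∈ U := U.add_mem (hWU im) (U.smul_mem t hY)
        have hrows : ∀ j : Fin n, (j : ℕ) < m → (W im + t • Y) j = 0 := by
          intro j hj
          have h1 : W im j = 0 := hWz im j (by rw [Fin.lt_def]; simpa [him] using hj)
          have h2 : Y j = 0 := hY0 j (Nat.lt_succ_of_lt hj)
          simp [h1, h2]
        have h := ih hmn.le (W im + t • Y) hmem hrows
        have hxy : Z m (W im + t • Y) = x + t • y := by
          funext i
          by_cases hi : (i : ℕ) < m
          · simp [Z, x, y, hi, hi.le]
          · by_cases hi' : (i : ℕ) = m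
            · have hYi : Y i = 0 := hY0 i (by omega)
              simp [Z, x, y, hi', hYi]
            · have hgt : ¬ (i : ℕ) ≤ m := by omega
              simp [Z, x, y, hi, hgt]
        have : perRows (x + t • y) = (Matrix.of (Z m (W im + t • Y))).permanent := by
          rw [hxy]; rfl
        rw [this]; exact h
      have hvan := stub_multilinearVanish perRows x y S hyS hline
      have hpw : S.piecewise y x = Z (m + 1) Y := by
        funext i
        by_cases hi : m < (i : ℕ)
        · have hiS : i ∈ S := by simp [S, hi]
          rw [Finset.piecewise_eq_of_mem _ _ _ hiS]
          have h1 : ¬ (i : ℕ) ≤ m := by omega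
          have h2 : ¬ (i : ℕ) < m + 1 := by omega
          simp [y, Z, h1, h2]
        · have hiS : i ∉ S := by simp [S, hi]
          rw [Finset.piecewise_eq_of_notMem _ _ _ hiS]
          by_cases hi' : (i : ℕ) < m
          · have h2 : (i : ℕ) < m + 1 := by omega
            simp [x, Z, hi', h2]
          · have hieq : i = im := Fin.ext (by simp [him]; omega)
            have h2 : (i : ℕ) < m + 1 := by omega
            have hx : x i = k i := by
              show (if (i : ℕ) < m then k i else W im i) = k i
              rw [if_neg hi', hieq, hWk im]
            rw [hx]; simp [Z, h2]
      have : (Matrix.of (Z (m + 1) Y)).permanent = perRows (S.piecewise y x) := by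
        rw [hpw]; rfl
      rw [this]; exact hvan
  have hfin := hZ n le_rfl 0 U.zero_mem (fun _ _ => rfl)
  have hZn : Z n 0 = k := by funext i; simp [Z, i.isLt]
  rwa [hZn] at hfin


/-- **Theorem (all `n`): a linear subspace of `M_n(ℂ)` on which the permanent vanishes identically
has dimension at most `n² - n`** — written `dim U + n ≤ n·n`; equality holds for the matrices with
a zero row (or column).  Product reduction (`stub_filtrationFinrank`, `productVanish`) and the
multilinear bound (`stub_perProductBound`).  The determinant analogue is Dieudonné's lemma
[Landsberg 2017, Lemma 6.6.1.4]. [folklore] -/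
theorem perVanishingSubspace_bound (n : ℕ) (U : Submodule ℂ (Fin n → Fin n → ℂ))
    (hU : ∀ X ∈ U, (Matrix.of X).permanent = 0) : Module.finrank ℂ U + n ≤ n * n := by
  rw [stub_filtrationFinrank U]
  exact stub_perProductBound n _ (fun X hX => productVanish U hU X hX)

/-- **Corollary: `sr(per_n) = n` — the slice rank (1-restricted strength) of the `n × n` permanent
is `n`.**  Any decomposition `per_n = Σ_{t<w} ℓ_t h_t` with linear forms `ℓ_t` has `w ≥ n` (and
the Laplace expansion along a row attains `w = n`); with GGIL22 Thm. 12 both end levels of every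
homogeneous ABP computing `per_n` have at least `n` vertices.
[cite: GesmundoGhosalIkenmeyerLysikov2022, Prop. 9, Thm. 12] -/
theorem sliceRank_perPoly (n w : ℕ) (ℓ h : Fin w → MvPolynomial (Fin n × Fin n) ℂ)
    (hℓ : ∀ t, (ℓ t).IsHomogeneous 1)
    (hper : Literature.Computability.AlgebraicComplexity.perPoly (Fin n) ℂ = ∑ t, ℓ t * h t) :
    n ≤ w :=
  stub_sliceRankOfBound n (perVanishingSubspace_bound n) w ℓ h hℓ hper

end Summit.ValiantsHypothesis.ValiantsHypothesis.Theorems.FreeSubtorusOrbitDimensionBound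

end
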